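/-
Copyright: the b2b-balaban T⁴-continuum CRUX team, row NE7b OWNER lineage `t4-ne7b-p1` (gen 119). Project licence.
-/
import Summits.QuantumFields.BalabanUV.T4Continuum.Spine.NE7b.SupConvexStepSemigroup

/-!
# THE SITEWISE ACTION IS IN THE TWO-SIDED CLASS: a symmetric operator with a two-sided form letter `γ·Σ h² ≤ Σ h·At h ≤ Γ·Σ h²`
# and a potential with `v′ = u`, `−λ ≤ u′ ≤ Λ_u` give `S φ = ½Σ φ·At φ + Σ v(φ x)` BOTH letters of (114)–(116)'s two-sided class —
# lower modulus `γ − λ` ((92) by name) and UPPER modulus `Γ + Λ_u` ((92) applied to `−S`); every operator on a finite carrier has the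
# crude form ceiling `Γ = |ι|·‖At‖`, so the torus action of (92)∕(110) with `|u′| ≤ λ` is in the two-sided class and the INTEGRATED
# step of (116) applies to it (row NE7b, node U5c; (92) + (110) + (93) BY NAME; [folklore])

Cell `pub-balaban`, sub-cell `t4`, spine estimate NE7b (`T4WeightBudget.RelWeightBound`; the cell's OWN estimate — NOT PRINTED in
[Bałaban 1983–89], NOT PROVED).  Crux-route work under `Spine/NE7b/` by the row OWNER (`t4-ne7b-p1` gen 119) under FREEZE (0)'s
crux-prover clause (the supplier of (115)∕(116)'s upper-letter hypothesis for the road's own action); NOTHING of Bałaban's is named as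
a Lean object, valued or asserted; no `T4Continuum/Support` leaf typed; no `def`, no notation; zero `sorry`.  Imports (BY NAME): the
OWNER's (110) `…SupConvexStepSemigroup` (`torus_action_mem_class`; through it (92) `action_firstOrder_lower`, (93) `norm_sq_le_sum_sq`,
(89) `torus_form_coercive`, TDF `torus_operator_form_symm`, TEA `exists_clm_pair` ∕ `hasFDerivAt_action`).

WHY (located).  (115)'s differentiability of the integrated effective action and (116)'s upper letter consume the UPPER letter
`S ψ ≤ S φ + S′φ(ψ − φ) + ½Λ·Σ(ψ − φ)²`, which no file of the convexity column states for the road's action.  It is (92)'s lower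
letter for the NEGATED action: `−S = ½Σ φ·(−At)φ + Σ(−v)(φ x)` has form floor `−Γ` and potential curvature `−u′ ≥ −Λ_u`, so (92) gives
`−S φ − S′φ(ψ − φ) + ½(−Γ − Λ_u)Σ(ψ − φ)² ≤ −S ψ`.  A form ceiling `Γ` always exists on a finite carrier (`|ι|·‖At‖`, sup-norm operator
norm; volume-dependent — a Schur row-sum bound on the periodised kernel would make it uniform, not typed here).

WHAT IS PROVED ([folklore]; finite carrier `ι`):
* §1 (TEA's level) `neg_form_symm`, **`action_firstOrder_upper`** (`Σ h·At h ≤ ΓΣ h²`, `u′ ≤ Λ_u` ⟹ the upper letter with modulus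
  `Γ + Λ_u`, `S′ = fderiv S`), **`action_mem_twoSided`** (two-sided form letter + `−λ ≤ u′ ≤ Λ_u` ⟹ `HasFDerivAt S (fderiv S φ) φ`,
  lower letter `γ − λ`, upper letter `Γ + Λ_u`), `form_le_card_mul_opNorm` (the crude ceiling `Σ h·At h ≤ |ι|‖At‖·Σ h²`).
* §2 (the `Beta.Site` carriers) **`torus_action_mem_twoSided`** (the torus action `At = Rf∘Aop∘Ef` with `|u′| ≤ λ` is in the
  two-sided class with `m = min(2,a) − λ` and `Λ = |Site|·‖At‖ + λ`).
* §3 toy.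

HONEST (what this is NOT).  Bookkeeping on (92); the torus ceiling `|Site|·‖At‖` depends on the volume (honest; uniform ceilings need
the kernel's row sums); `φ⁴` has no global `Λ_u` (excluded, as in (114)); nothing of Bałaban's ((A3), NC-NE7b-α UNRULED).  BY-NAME
EFFECT ON THE WALL: NONE.  NE7b NOT PRINTED ∕ NOT PROVED; spine PROVED 0∕9; rung (B)+1 on a FINITE torus — NOT infinite volume, NOT the
mass gap, NOT Clay.  HONEST DEPENDENCY: continuum YM on T⁴ ⇐ BetaPertH ∧ nine spine estimates (0∕9 proved); BetaPertH ⇐ (D1) ∧ (D4) ∧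
CAP+tail; G-an2-4 gates asym, D1 and NE2∕3∕4.
-/

set_option autoImplicit false

noncomputable section

namespace Summit.QuantumFields.BalabanUV.T4Continuum.NE7b.SupConvexClassTwoSidedAction

open Set Function
open scoped ENNReal
open Literature.MathematicalPhysics.QuantumFieldTheory.Balaban1983to89
open B6QGQLower276 (X blk B side AX)
open B5Hk103ScalarZd (nbhd)
open Beta (Site siteOf windowMap)
open SupTorusDirichletForm (torus_operator_form_symm)
open SupTorusDirichletFormCoercive (torus_form_coercive)
open SupTorusActionConvex (action_firstOrder_lower)
open SupTorusActionMinimiser (norm_sq_le_sum_sq)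
open SupConvexStepSemigroup (torus_action_mem_class)

variable {d : ℕ}

/-! ## §1. The upper letter of the sitewise action; the two-sided membership -/

section TEA

variable {ι : Type*} [Fintype ι]

/-- The negated operator has a symmetric form if `At` has. [folklore] -/
theorem neg_form_symm (At : (ι → ℝ) →L[ℝ] (ι → ℝ)) (hAt : ∀ φ ψ : ι → ℝ, ∑ x, ψ x * At φ x = ∑ x, φ x * At ψ x)
    (φ ψ : ι → ℝ) : ∑ x, ψ x * (-At) φ x = ∑ x, φ x * (-At) ψ x := by
  simp only [neg_apply, Pi.neg_apply, mul_neg, Finset.sum_neg_distrib, hAt]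

/-- **THE UPPER LETTER OF THE ACTION**: a symmetric `At` with form CEILING `Σ h·At h ≤ Γ·Σ h²`, `v′ = u`, `u′` a derivative of `u` with
`u′ ≤ Λ_u` ⟹ for all `φ ψ`: `S ψ ≤ S φ + DS(φ)(ψ − φ) + ½(Γ + Λ_u)·Σ(ψ − φ)²` — (92)'s lower letter for `−S`. [folklore] -/
theorem action_firstOrder_upper (At : (ι → ℝ) →L[ℝ] (ι → ℝ))
    (hAt : ∀ φ ψ : ι → ℝ, ∑ x, ψ x * At φ x = ∑ x, φ x * At ψ x) {Γ : ℝ}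
    (hΓ : ∀ h : ι → ℝ, ∑ x, h x * At h x ≤ Γ * ∑ x, h x ^ 2) {v u u' : ℝ → ℝ} (hv : ∀ t, HasDerivAt v (u t) t)
    (hu : ∀ t, HasDerivAt u (u' t) t) {Λu : ℝ} (hu' : ∀ t, u' t ≤ Λu) (φ ψ : ι → ℝ) :
    (1 / 2 : ℝ) * ∑ x, ψ x * At ψ x + ∑ x, v (ψ x) ≤
      ((1 / 2 : ℝ) * ∑ x, φ x * At φ x + ∑ x, v (φ x))
        + fderiv ℝ (fun φ : ι → ℝ => (1 / 2 : ℝ) * ∑ x, φ x * At φ x + ∑ x, v (φ x)) φ (ψ - φ)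
        + (Γ + Λu) / 2 * ∑ x, (ψ x - φ x) ^ 2 := by
  set S₀ : (ι → ℝ) → ℝ := fun φ => (1 / 2 : ℝ) * ∑ x, φ x * At φ x + ∑ x, v (φ x) with hS₀
  have hγ' : ∀ h : ι → ℝ, -Γ * ∑ x, h x ^ 2 ≤ ∑ x, h x * (-At) h x := fun h => by
    simp only [neg_apply, Pi.neg_apply, mul_neg, Finset.sum_neg_distrib]
    linarith [hΓ h]
  have key := action_firstOrder_lower (-At) (neg_form_symm At hAt) hγ' (v := fun t => -v t) (u := fun t => -u t)
    (u' := fun t => -u' t) (fun t => (hv t).neg) (fun t => (hu t).neg) (lam := Λu) (fun t => neg_le_neg (hu' t)) φ ψ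
  have hneg : (fun φ : ι → ℝ => (1 / 2 : ℝ) * ∑ x, φ x * (-At) φ x + ∑ x, -v (φ x)) = -S₀ := by
    funext φ
    simp only [hS₀, Pi.neg_apply, neg_apply, mul_neg, Finset.sum_neg_distrib]
    ring
  rw [hneg, fderiv_neg] at key
  simp only [Pi.neg_apply, neg_apply] at key
  have e3 : ∀ χ : ι → ℝ, (1 / 2 : ℝ) * ∑ x, χ x * -At χ x + ∑ x, -v (χ x) =
      -((1 / 2 : ℝ) * ∑ x, χ x * At χ x + ∑ x, v (χ x)) := fun χ => by
    simp only [mul_neg, Finset.sum_neg_distrib]; ring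
  have e1 : S₀ φ = (1 / 2 : ℝ) * ∑ x, φ x * At φ x + ∑ x, v (φ x) := rfl
  have e2 : S₀ ψ = (1 / 2 : ℝ) * ∑ x, ψ x * At ψ x + ∑ x, v (ψ x) := rfl
  linarith [e3 φ, e3 ψ]

/-- **THE SITEWISE ACTION IS IN THE TWO-SIDED CLASS**: symmetric `At` with `γ·Σ h² ≤ Σ h·At h ≤ Γ·Σ h²`, `v′ = u`, `−λ ≤ u′ ≤ Λ_u`
⟹ with `S′ = fderiv S`: `HasFDerivAt S (S′φ) φ` everywhere, the lower letter with modulus `γ − λ` and the upper letter with modulus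
`Γ + Λ_u` — the three hypotheses of (115)∕(116). [folklore] -/
theorem action_mem_twoSided (At : (ι → ℝ) →L[ℝ] (ι → ℝ))
    (hAt : ∀ φ ψ : ι → ℝ, ∑ x, ψ x * At φ x = ∑ x, φ x * At ψ x) {γ Γ : ℝ}
    (hγ : ∀ h : ι → ℝ, γ * ∑ x, h x ^ 2 ≤ ∑ x, h x * At h x) (hΓ : ∀ h : ι → ℝ, ∑ x, h x * At h x ≤ Γ * ∑ x, h x ^ 2)
    {v u u' : ℝ → ℝ} (hv : ∀ t, HasDerivAt v (u t) t) (hu : ∀ t, HasDerivAt u (u' t) t) {lam Λu : ℝ}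
    (hu'lo : ∀ t, -lam ≤ u' t) (hu'up : ∀ t, u' t ≤ Λu) :
    (∀ φ : ι → ℝ, HasFDerivAt (fun φ : ι → ℝ => (1 / 2 : ℝ) * ∑ x, φ x * At φ x + ∑ x, v (φ x))
        (fderiv ℝ (fun φ : ι → ℝ => (1 / 2 : ℝ) * ∑ x, φ x * At φ x + ∑ x, v (φ x)) φ) φ) ∧
    (∀ φ ψ : ι → ℝ, ((1 / 2 : ℝ) * ∑ x, φ x * At φ x + ∑ x, v (φ x))
        + fderiv ℝ (fun φ : ι → ℝ => (1 / 2 : ℝ) * ∑ x, φ x * At φ x + ∑ x, v (φ x)) φ (ψ - φ)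
        + (γ - lam) / 2 * ∑ x, (ψ x - φ x) ^ 2
      ≤ (1 / 2 : ℝ) * ∑ x, ψ x * At ψ x + ∑ x, v (ψ x)) ∧
    ∀ φ ψ : ι → ℝ, (1 / 2 : ℝ) * ∑ x, ψ x * At ψ x + ∑ x, v (ψ x) ≤
      ((1 / 2 : ℝ) * ∑ x, φ x * At φ x + ∑ x, v (φ x))
        + fderiv ℝ (fun φ : ι → ℝ => (1 / 2 : ℝ) * ∑ x, φ x * At φ x + ∑ x, v (φ x)) φ (ψ - φ)
        + (Γ + Λu) / 2 * ∑ x, (ψ x - φ x) ^ 2 := by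
  refine ⟨fun φ => ?_, fun φ ψ => action_firstOrder_lower At hAt hγ hv hu hu'lo φ ψ,
    fun φ ψ => action_firstOrder_upper At hAt hΓ hv hu hu'up φ ψ⟩
  obtain ⟨L, hL⟩ := SupTorusEffectiveAction.exists_clm_pair (fun x => At φ x + u (φ x))
  exact (SupTorusEffectiveAction.hasFDerivAt_action At hAt hv φ hL).differentiableAt.hasFDerivAt

/-- **EVERY OPERATOR ON A FINITE CARRIER HAS A FORM CEILING**: `Σ_x h x·(At h) x ≤ |ι|·‖At‖·Σ_x (h x)²` (sup-norm operator norm;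
volume-dependent). [folklore] -/
theorem form_le_card_mul_opNorm (At : (ι → ℝ) →L[ℝ] (ι → ℝ)) (h : ι → ℝ) :
    ∑ x, h x * At h x ≤ Fintype.card ι * ‖At‖ * ∑ x, h x ^ 2 := by
  have hterm : ∀ x, h x * At h x ≤ ‖At‖ * ‖h‖ ^ 2 := fun x => by
    have h1 : |h x| ≤ ‖h‖ := by have := norm_le_pi_norm h x; rwa [Real.norm_eq_abs] at this
    have h2 : |At h x| ≤ ‖At‖ * ‖h‖ := by
      have := norm_le_pi_norm (At h) x
      rw [Real.norm_eq_abs] at this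
      exact this.trans (At.le_opNorm h)
    calc h x * At h x ≤ |h x * At h x| := le_abs_self _
      _ = |h x| * |At h x| := abs_mul _ _
      _ ≤ ‖h‖ * (‖At‖ * ‖h‖) := mul_le_mul h1 h2 (abs_nonneg _) (norm_nonneg _)
      _ = ‖At‖ * ‖h‖ ^ 2 := by ring
  calc ∑ x, h x * At h x ≤ ∑ _x : ι, ‖At‖ * ‖h‖ ^ 2 := Finset.sum_le_sum fun x _ => hterm x
    _ = Fintype.card ι * (‖At‖ * ‖h‖ ^ 2) := by rw [Finset.sum_const, Finset.card_univ, nsmul_eq_mul]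
    _ ≤ Fintype.card ι * (‖At‖ * ∑ x, h x ^ 2) :=
        mul_le_mul_of_nonneg_left (mul_le_mul_of_nonneg_left (norm_sq_le_sum_sq h) (norm_nonneg _)) (Nat.cast_nonneg _)
    _ = Fintype.card ι * ‖At‖ * ∑ x, h x ^ 2 := by ring

end TEA

/-! ## §2. The torus action is in the two-sided class -/

section Torus

variable (n : ℕ) (a : ℝ) (s : ℕ) [NeZero s]
  {Aop : lp (fun _ : X d => ℝ) ∞ →L[ℝ] lp (fun _ : X d => ℝ) ∞}
  (hA : ∀ (f : lp (fun _ : X d => ℝ) ∞) (p : X d), Aop f p = ∑ r ∈ nbhd n p, AX n a p r * f r)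
  {v u u' : ℝ → ℝ} (hv : ∀ t, HasDerivAt v (u t) t) (hu : ∀ t, HasDerivAt u (u' t) t)
  {lam : ℝ} (hlam : ∀ t, |u' t| ≤ lam)
  {Ef : (Site d ((n + 1) * s) → ℝ) →L[ℝ] lp (fun _ : X d => ℝ) ∞}
  (hEf : ∀ (g : Site d ((n + 1) * s) → ℝ) (q : X d), Ef g q = g (siteOf d ((n + 1) * s) q))
  {Rf : lp (fun _ : X d => ℝ) ∞ →L[ℝ] (Site d ((n + 1) * s) → ℝ)}
  (hRf : ∀ (h : lp (fun _ : X d => ℝ) ∞) (x : Site d ((n + 1) * s)), Rf h x = h (windowMap d ((n + 1) * s) x))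

include hA hv hu hlam hEf hRf in
/-- **THE TORUS ACTION IS IN THE TWO-SIDED CLASS**: `At = Rf∘Aop∘Ef` (floor `min(2,a)` by (89), ceiling `|Site|·‖At‖` by §1),
`v′ = u`, `|u′| ≤ λ` ⟹ with `S′ = fderiv S`: `HasFDerivAt` everywhere, the lower letter with `m = min(2,a) − λ` and the upper letter with
`Λ = |Site d ((n+1)s)|·‖At‖ + λ` — so (115)'s differentiability, (116)'s `integratedStep_closure` and (117)'s sandwich apply to the torus
action along ANY block map ∕ chart (for `λ < min(2,a)`). [folklore] -/
theorem torus_action_mem_twoSided :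
    (∀ φ : Site d ((n + 1) * s) → ℝ,
      HasFDerivAt (fun φ : Site d ((n + 1) * s) → ℝ => (1 / 2 : ℝ) * ∑ x, φ x * ((Rf.comp Aop).comp Ef) φ x + ∑ x, v (φ x))
        (fderiv ℝ (fun φ : Site d ((n + 1) * s) → ℝ =>
          (1 / 2 : ℝ) * ∑ x, φ x * ((Rf.comp Aop).comp Ef) φ x + ∑ x, v (φ x)) φ) φ) ∧
    (∀ φ ψ : Site d ((n + 1) * s) → ℝ,
      ((1 / 2 : ℝ) * ∑ x, φ x * ((Rf.comp Aop).comp Ef) φ x + ∑ x, v (φ x))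
        + fderiv ℝ (fun φ : Site d ((n + 1) * s) → ℝ =>
            (1 / 2 : ℝ) * ∑ x, φ x * ((Rf.comp Aop).comp Ef) φ x + ∑ x, v (φ x)) φ (ψ - φ)
        + (min 2 a - lam) / 2 * ∑ x, (ψ x - φ x) ^ 2
      ≤ (1 / 2 : ℝ) * ∑ x, ψ x * ((Rf.comp Aop).comp Ef) ψ x + ∑ x, v (ψ x)) ∧
    ∀ φ ψ : Site d ((n + 1) * s) → ℝ,
      (1 / 2 : ℝ) * ∑ x, ψ x * ((Rf.comp Aop).comp Ef) ψ x + ∑ x, v (ψ x) ≤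
      ((1 / 2 : ℝ) * ∑ x, φ x * ((Rf.comp Aop).comp Ef) φ x + ∑ x, v (φ x))
        + fderiv ℝ (fun φ : Site d ((n + 1) * s) → ℝ =>
            (1 / 2 : ℝ) * ∑ x, φ x * ((Rf.comp Aop).comp Ef) φ x + ∑ x, v (φ x)) φ (ψ - φ)
        + (Fintype.card (Site d ((n + 1) * s)) * ‖(Rf.comp Aop).comp Ef‖ + lam) / 2 * ∑ x, (ψ x - φ x) ^ 2 :=
  action_mem_twoSided ((Rf.comp Aop).comp Ef) (torus_operator_form_symm n a s hA hEf hRf) (torus_form_coercive n a s hA hEf hRf)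
    (form_le_card_mul_opNorm _) hv hu (fun t => (abs_le.1 (hlam t)).1) (fun t => (abs_le.1 (hlam t)).2)

end Torus

/-! ## §3. Toy -/

/-- Toy (§1 `form_le_card_mul_opNorm` with the identity operator on one site): `Σ h·h ≤ 1·‖1‖·Σ h²`. -/
example (h : Unit → ℝ) :
    ∑ x, h x * (ContinuousLinearMap.id ℝ (Unit → ℝ)) h x ≤
      Fintype.card Unit * ‖ContinuousLinearMap.id ℝ (Unit → ℝ)‖ * ∑ x, h x ^ 2 :=
  form_le_card_mul_opNorm _ h

end Summit.QuantumFields.BalabanUV.T4Continuum.NE7b.SupConvexClassTwoSidedAction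

end
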